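import Literature.AlgebraicGeometry.HodgeTheory.ProjectiveCompleteIntersectionCayleyBacharach
import Literature.AlgebraicGeometry.HodgeTheory.ProjectiveHypersurfaceSectionDimension
import Literature.AlgebraicGeometry.HodgeTheory.ProjectiveZeroDimensionalRegularity
import HarnessLib

/-!
# The Hilbert function of a complete-intersection zero-scheme: `H_Z(n) + H_Z(s - n) = deg Z`

Eisenbud–Green–Harris, *Cayley–Bacharach theorems and conjectures* (Bull. AMS 33, 1996),
**Thm. CB7**: for hypersurfaces `X_1, …, X_n ⊂ ℙ^n` of degrees `d_i` meeting in a zero-dimensional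
`Γ`, `Γ', Γ''` residual to one another in `Γ`, `s = Σ d_i - n - 1` and `k ≤ s`, "the dimension of
the family of curves of degree `k` containing `Γ'` (modulo those containing all of `Γ`) is equal
to the failure of `Γ''` to impose independent conditions of curves of complementary degree `s - k`";
§1.3 / **Thm. CB8**: "`A = S/(F_1, …, F_n, L)` is itself Gorenstein, with socle in degree `m` …
the dimension of the `j`th graded piece of `I'` is the codimension of the `(m - j)`th graded piece of
`I''`. Summing this equality over `j = 0, 1, …, l` yields the statement". Bruns–Herzog,
*Cohen–Macaulay Rings*, **Cor. 4.4.6 (Stanley) / Rem. 4.4.7 (a)**: for `R` Gorenstein,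
`H_R(t) = (-1)^d t^{a(R)} H_R(t^{-1})`, "equivalent to … the symmetry of the polynomial `Q_R(t)`".

This file proves the case `Γ' = ∅`, `Γ'' = Γ` of CB7 — **the Hilbert function of a
complete-intersection zero-scheme `Z = V(f_1, …, f_r) ⊂ ℙ^r` is symmetric about `s/2`:
`H_Z(n) + H_Z(s - n) = deg Z`** (`s = Σ d_i - r - 1`; `H_Z(k)` = the number of hypersurfaces of
degree `k` "containing `∅` modulo those containing `Γ`", `deg Z - H_Z(s - k)` = the failure of `Γ`
in degree `s - k`) — in the tree's Čech language (`Literature/Algebra/Homology/LaurentCech*`: ideals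
as submodules of `S^{pt}`, `H_Z(n) = dim_k (S^{pt})_n ⧸ ((f)S^{pt})_n` via `degPiece`), for `f_i`
forms of positive degrees weakly regular on `S^{pt}`, `k` infinite, `r ≥ 1`, `deg Z = Π d_i`
(Bézout, `ProjectiveCompleteIntersectionBezout`):

* `finrank_degPiece_ideal_smul_top_eq` — the bridge `dim (S^{pt})_m = dim S_m`,
  `dim ((I·S^{pt})_m) = dim I_m` to the `MvPolynomial` dictionary (`homogeneousSubmodule`,
  `idealDegree`) of `HodgeTheory/CompleteIntersectionHilbertFunction` and
  `DuqueFrancoVillaflor2025/ArtinianGorensteinIdeal`;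
* **`finrank_quotient_degPiece_sup_smul_top_add_eq`** — `H_{M/gM}(d + c) + H_M(d) = H_M(d + c)`
  for a homogeneous non-zero-divisor `g` of degree `c` on `M = F_e ⧸ K` (general `F_e`);
* `isArtinianGorenstein_ofList_append_linearForm` — Macaulay: `S ⧸ (f_1, …, f_r, ℓ)` is Artinian
  Gorenstein of socle degree `σ = Σ d_i - r` for `ℓ` linear and regular modulo `(f)`;
* **`finrank_quotient_degPiece_add_eq_degree_completeIntersection`** — `H_Z(n) + H_Z(n') = Π d_i`
  whenever `n + n' = Σ d_i - r - 1` (all `n ∈ ℤ`): `H_R(m) = H_Z(m) - H_Z(m-1)` is symmetric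
  (`IsArtinianGorenstein.hilbert_symm`) and vanishes for `m > σ`;
* `finrank_quotient_degPiece_zero_completeIntersection` — `H_Z(0) = 1`;
* **`finrank_quotient_degPiece_eq_degree_iff_completeIntersection`** — the index of regularity:
  `H_Z(n) = deg Z ⟺ n ≥ Σ d_i - r`;
* **`finrank_quotient_degPiece_completeIntersection_socle_pred`** — `H_Z(s) = deg Z - 1`: `Z`
  fails by exactly one to impose independent conditions in degree `s` (nine points of two cubics
  impose eight conditions on cubics);
* **`regular_cech_completeIntersection_dimZero_iff`** — `𝓘_Z` is `m`-regular iff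
  `m ≥ Σ d_i - r + 1` (`r ≥ 2`): the regularity of a complete-intersection zero-scheme is exactly
  `Σ d_i - r + 1`.

Theorems only; no definitions, no named facts.

## References

* [EisenbudGreenHarris1996] D. Eisenbud, M. Green, J. Harris, *Cayley–Bacharach theorems and
  conjectures*, Bull. Amer. Math. Soc. 33 (1996), 295–324, Thms. CB4, CB7, CB8, §1.3.
* [BrunsHerzog1998] W. Bruns, J. Herzog, *Cohen–Macaulay Rings*, rev. ed., CUP (1998), Cor. 4.4.6,
  Rem. 4.4.7 (a).
* [Hartshorne1977] R. Hartshorne, *Algebraic Geometry*, GTM 52 (1977), I Prop. 7.6, Thm. 7.7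
  (pp. 52–53), III Ex. 5.5 (p. 231).
* [Eisenbud2005] D. Eisenbud, *The Geometry of Syzygies*, GTM 229 (2005), Thm. 4.2, Cor. 4.8.
* [Matsumura1987] H. Matsumura, *Commutative Ring Theory* (1987), Thm. 13.4 (p. 96).
* [CarlsonMullerStachPeters2017] J. Carlson, S. Müller-Stach, C. Peters, *Period Mappings and Period
  Domains*, 2nd ed. (2017), Thm. 7.4.1.
* [GortzWedhorn2020] U. Görtz, T. Wedhorn, *Algebraic Geometry I*, 2nd ed. (2020), (13.1).
-/

noncomputable section

open CategoryTheory CategoryTheory.Limits Polynomial Pointwise RingTheory.Sequence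
open scoped Nat

universe u

namespace Literature.Algebra.Homology

namespace LaurentCech

open OrderedCech TopCohomology Literature.AlgebraicGeometry.DuqueFrancoVillaflor2025
  Literature.AlgebraicGeometry.HodgeTheory Literature.RingTheory.MvPolynomial

variable {k : Type u} [Field k] {r : ℕ}

/-! ### The degree pieces of `I·S^{pt}` and the pieces `I_m = I ∩ S_m` of the ideal `I` -/

/-- `v ∈ I·S^{pt} ⟺ v(pt) ∈ I`. [folklore] -/
private theorem mem_ideal_smul_top_iff' (I : Ideal (P k r)) (v : Unit → P k r) :
    v ∈ I • (⊤ : Submodule (P k r) (Unit → P k r)) ↔ v () ∈ I := by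
  constructor
  · intro hv
    refine Submodule.smul_induction_on hv (fun a ha w _ => ?_) (fun x y hx hy => ?_)
    · rw [Pi.smul_apply, smul_eq_mul]
      exact I.mul_mem_right _ ha
    · rw [Pi.add_apply]
      exact I.add_mem hx hy
  · intro hv
    have : v = (v ()) • (fun _ : Unit => (1 : P k r)) := by
      funext u
      rw [Pi.smul_apply, smul_eq_mul, mul_one]
    rw [this]
    exact Submodule.smul_mem_smul hv Submodule.mem_top

/-- **`dim_k (S^{pt})_m = dim_k S_m` and `dim_k (I·S^{pt})_m = dim_k I_m`**: the degree pieces of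
the
Čech dictionary (`degPiece`, vectors of forms) and of the `MvPolynomial` dictionary
(`homogeneousSubmodule`, `idealDegree I m = I ∩ S_m`) have the same dimensions — evaluation at the
point is an isomorphism `(S^{pt})_m ⥲ S_m` carrying `(I·S^{pt})_m` onto `I_m`.
[cite: GortzWedhorn2020, (13.1) (PDF p. 466)] [cite: Hartshorne1977, I §7 (p. 49)] -/
theorem finrank_degPiece_ideal_smul_top_eq (I : Ideal (P k r)) (m : ℕ) :
    Module.finrank k (Unit → (Ldeg k r ((m : ℤ) - 0)).comap (toL k r).toLinearMap) =
      Module.finrank k (MvPolynomial.homogeneousSubmodule (Fin (r + 1)) k m) ∧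
    Module.finrank k (degPiece (fun _ : Unit => (0 : ℤ))
        (I • (⊤ : Submodule (P k r) (Unit → P k r))) m) =
      Module.finrank k (idealDegree I m) := by
  -- evaluation at the point, as a `k`-linear map `(S^{pt})_m → S`
  let Φ : (Unit → (Ldeg k r ((m : ℤ) - 0)).comap (toL k r).toLinearMap) →ₗ[k] P k r :=
    ((Ldeg k r ((m : ℤ) - 0)).comap (toL k r).toLinearMap).subtype.restrictScalars k ∘ₗ
      (LinearMap.proj (R := k) ())
  have hΦ : ∀ q, Φ q = (q () : P k r) := fun q => rfl
  have hΦinj : Function.Injective Φ := by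
    intro x y hxy
    funext u
    apply Subtype.ext
    rw [hΦ, hΦ] at hxy
    cases u
    exact hxy
  have hLdeg : Ldeg k r ((m : ℤ) - 0) = Ldeg k r m := by rw [sub_zero]
  have hmemF : ∀ q : Unit → (Ldeg k r ((m : ℤ) - 0)).comap (toL k r).toLinearMap,
      (q () : P k r).IsHomogeneous m := by
    intro q
    have h2 : (q () : P k r) ∈ (Ldeg k r ((m : ℤ) - 0)).comap (toL k r).toLinearMap := (q ()).2
    rw [Submodule.mem_comap] at h2
    exact (toL_mem_Ldeg_iff _ m).1 (hLdeg.le h2)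
  have hlift : ∀ p : P k r, p.IsHomogeneous m →
      ∃ q : Unit → (Ldeg k r ((m : ℤ) - 0)).comap (toL k r).toLinearMap, Φ q = p := by
    intro p hp
    have hp' : p ∈ (Ldeg k r ((m : ℤ) - 0)).comap (toL k r).toLinearMap := by
      rw [Submodule.mem_comap]
      exact hLdeg.symm.le ((toL_mem_Ldeg_iff p m).2 hp)
    exact ⟨fun _ => ⟨p, hp'⟩, rfl⟩
  have hrange : LinearMap.range Φ = MvPolynomial.homogeneousSubmodule (Fin (r + 1)) k m := by
    apply le_antisymm
    · rintro p ⟨q, rfl⟩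
      exact (MvPolynomial.mem_homogeneousSubmodule m _).2 (hmemF q)
    · intro p hp
      obtain ⟨q, hq⟩ := hlift p ((MvPolynomial.mem_homogeneousSubmodule m p).1 hp)
      exact ⟨q, hq⟩
  have hmap : Submodule.map Φ (degPiece (fun _ : Unit => (0 : ℤ))
      (I • (⊤ : Submodule (P k r) (Unit → P k r))) m) = idealDegree I m := by
    apply le_antisymm
    · rintro p ⟨q, hq, rfl⟩
      rw [SetLike.mem_coe, mem_degPiece, mem_ideal_smul_top_iff'] at hq
      exact mem_idealDegree.2 ⟨hq, hmemF q⟩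
    · intro p hp
      obtain ⟨hpI, hpm⟩ := mem_idealDegree.1 hp
      obtain ⟨q, hq⟩ := hlift p hpm
      refine ⟨q, ?_, hq⟩
      rw [SetLike.mem_coe, mem_degPiece, mem_ideal_smul_top_iff']
      rw [hΦ] at hq
      show (q () : P k r) ∈ I
      rw [hq]; exact hpI
  constructor
  · rw [← hrange]; exact (LinearMap.finrank_range_of_inj hΦinj).symm
  · rw [← hmap]; exact (Submodule.equivMapOfInjective Φ hΦinj _).finrank_eq

/-! ### The exact hyperplane-section recursion `H_{M/gM}(d') = H_M(d') - H_M(d)` for `g` regular -/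

section Recursion

variable {J : Type} [Fintype J] (e : J → ℤ)

/-- **`H_{M/gM}(d + c) + H_M(d) = H_M(d + c)` for `g` a homogeneous non-zero-divisor of degree `c`
on `M = F_e ⧸ K`** (`K` graded; `H_M(n) = dim_k (F_e)_n ⧸ K_n`): the degree-`d + c` part of
`0 → M(-c) →^{g} M → M ⧸ gM → 0`. Refines the inequality
`finrank_quotient_degPiece_le_sup_smul_top_add` (any `g`) to an equality for regular `g`.
[cite: Matsumura1987, Thm. 13.4, proof of Step 2 (p. 96)] [cite: Hartshorne1977, I Prop. 7.6 (proof,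
p. 52)] -/
theorem finrank_quotient_degPiece_sup_smul_top_add_eq {K : Submodule (P k r) (J → P k r)}
    (hK : IsGraded e K) {c : ℤ} {g : P k r} (hg : toL k r g ∈ Ldeg k r c)
    (hreg : ∀ v : J → P k r, g • v ∈ K → v ∈ K) (d d' : ℤ) (h : d + c = d') :
    Module.finrank k ((∀ j, (Ldeg k r (d' - e j)).comap (toL k r).toLinearMap) ⧸
        degPiece e (K ⊔ g • (⊤ : Submodule (P k r) (J → P k r))) d') +
      Module.finrank k ((∀ j, (Ldeg k r (d - e j)).comap (toL k r).toLinearMap) ⧸ degPiece e K d) =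
    Module.finrank k ((∀ j, (Ldeg k r (d' - e j)).comap (toL k r).toLinearMap) ⧸
        degPiece e K d') := by
  haveI := moduleFinite_pi_comap_toL_Ldeg (k := k) (r := r) e d
  haveI := moduleFinite_pi_comap_toL_Ldeg (k := k) (r := r) e d'
  have hqK := Submodule.finrank_quotient_add_finrank (degPiece e K d)
  have hqK' := Submodule.finrank_quotient_add_finrank (degPiece e K d')
  have hqK₁ := Submodule.finrank_quotient_add_finrank
    (degPiece e (K ⊔ g • (⊤ : Submodule (P k r) (J → P k r))) d')
  by_cases hg0 : g = 0
  · -- `g = 0` regular forces `K = F_e`: all three quotients vanish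
    have hKtop : K = ⊤ := eq_top_iff.2 fun v _ => hreg v (by rw [hg0, zero_smul]; exact K.zero_mem)
    have h1 : degPiece e K d = ⊤ := eq_top_iff.2 fun q _ => by
      rw [mem_degPiece, hKtop]; exact Submodule.mem_top
    have h2 : degPiece e K d' = ⊤ := eq_top_iff.2 fun q _ => by
      rw [mem_degPiece, hKtop]; exact Submodule.mem_top
    have h3 : degPiece e (K ⊔ g • (⊤ : Submodule (P k r) (J → P k r))) d' = ⊤ :=
      eq_top_iff.2 (h2.symm.le.trans (degPiece_mono e le_sup_left d'))
    have h1' : Module.finrank k ↥(degPiece e K d) =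
        Module.finrank k (∀ j, (Ldeg k r (d - e j)).comap (toL k r).toLinearMap) := by
      rw [h1]; exact finrank_top _ _
    have h2' : Module.finrank k ↥(degPiece e K d') =
        Module.finrank k (∀ j, (Ldeg k r (d' - e j)).comap (toL k r).toLinearMap) := by
      rw [h2]; exact finrank_top _ _
    have h3' : Module.finrank k ↥(degPiece e (K ⊔ g • (⊤ : Submodule (P k r) (J → P k r))) d') =
        Module.finrank k (∀ j, (Ldeg k r (d' - e j)).comap (toL k r).toLinearMap) := by
      rw [h3]; exact finrank_top _ _
    omega
  obtain ⟨ψ, hψ⟩ := exists_linearMap_mul e g hg d d' h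
  have hψinj : Function.Injective ψ := by
    intro x y hxy
    funext j
    apply Subtype.ext
    have hj := congr_arg (fun z => ((z j : _) : P k r)) hxy
    simp only [hψ] at hj
    exact mul_left_cancel₀ hg0 hj
  have hsup := degPiece_sup_smul_top_eq e hK hg h hψ
  have hinf : degPiece e K d' ⊓ LinearMap.range ψ = (degPiece e K d).map ψ := by
    apply le_antisymm
    · rintro x ⟨hx, q, rfl⟩
      exact ⟨q, (linearMap_mul_mem_degPiece_iff e K hreg hψ q).1 hx, rfl⟩
    · rintro x ⟨q, hq, rfl⟩
      exact ⟨linearMap_mul_mem_degPiece e K hψ hq, q, rfl⟩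
  have hdim := Submodule.finrank_sup_add_finrank_inf_eq (degPiece e K d') (LinearMap.range ψ)
  rw [hinf, ← hsup, LinearMap.finrank_range_of_inj hψinj,
    (Submodule.equivMapOfInjective ψ hψinj _).finrank_eq.symm] at hdim
  omega

end Recursion

/-! ### Macaulay's theorem for `(f_1, …, f_r, ℓ)` in the submodule language -/

/-- `(I + (ℓ))·S^{pt} = I·S^{pt} + ℓ S^{pt}`. [folklore] -/
private theorem ofList_append_singleton_smul_top' (l : List (P k r)) (ℓ : P k r) :
    Ideal.ofList (l ++ [ℓ]) • (⊤ : Submodule (P k r) (Unit → P k r)) =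
      Ideal.ofList l • (⊤ : Submodule (P k r) (Unit → P k r)) ⊔ ℓ • ⊤ := by
  rw [Ideal.ofList_append, Submodule.sup_smul, Ideal.ofList_singleton,
    Submodule.ideal_span_singleton_smul]

/-- **Macaulay: `S ⧸ (f_1, …, f_r, ℓ)` is Artinian Gorenstein of socle degree `σ = Σ d_i - r`** for
forms `f_i` of positive degrees `d_i` weakly regular on `S^{pt}` and a linear form `ℓ` regular
    modulo
`(f_1, …, f_r)S^{pt}` (the tree's `isArtinianGorenstein_span_of_forall_mul_mem` for the square
    system
`(f_1, …, f_r, ℓ)`, degrees `(d_1, …, d_r, 1)`, transported from `IsWeaklyRegular (S^{pt})`).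
[cite: EisenbudGreenHarris1996, Thm. CB8] [cite: CarlsonMullerStachPeters2017, Thm. 7.4.1] -/
theorem isArtinianGorenstein_ofList_append_linearForm (fs : List (P k r × ℕ)) (hlen : fs.length = r)
    (hhom : ∀ fc ∈ fs, fc.1.IsHomogeneous fc.2) (hpos : ∀ fc ∈ fs, 0 < fc.2)
    (hreg : IsWeaklyRegular (Unit → P k r) (fs.map Prod.fst)) {ℓ : P k r}
    (hℓ1 : ℓ.IsHomogeneous 1)
    (hℓreg : ∀ v : Unit → P k r,
      ℓ • v ∈ Ideal.ofList (fs.map Prod.fst) • (⊤ : Submodule (P k r) (Unit → P k r)) →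
        v ∈ Ideal.ofList (fs.map Prod.fst) • (⊤ : Submodule (P k r) (Unit → P k r)))
    {σ : ℕ} (hσr : σ + r = (fs.map Prod.snd).sum) :
    IsArtinianGorenstein (Ideal.ofList (fs.map Prod.fst ++ [ℓ])) σ := by
  set fcs : List (P k r × ℕ) := fs ++ [(ℓ, 1)] with hfcs
  have hfcslen : fcs.length = r + 1 := by rw [hfcs, List.length_append, hlen]; rfl
  let G : Fin (r + 1) → P k r := fun i => (fcs.get (Fin.cast hfcslen.symm i)).1
  let d : Fin (r + 1) → ℕ := fun i => (fcs.get (Fin.cast hfcslen.symm i)).2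
  have hmemfcs : ∀ fc ∈ fcs, fc.1.IsHomogeneous fc.2 ∧ 0 < fc.2 := by
    intro fc hfc
    rw [hfcs, List.mem_append, List.mem_singleton] at hfc
    rcases hfc with hfc | rfl
    · exact ⟨hhom fc hfc, hpos fc hfc⟩
    · exact ⟨hℓ1, one_pos⟩
  have hG : ∀ i, (G i).IsHomogeneous (d i) := fun i => (hmemfcs _ (List.get_mem _ _)).1
  have hd : ∀ i, 0 < d i := fun i => (hmemfcs _ (List.get_mem _ _)).2
  have hofFn : List.ofFn G = fcs.map Prod.fst := by
    apply List.ext_get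
    · rw [List.length_ofFn, List.length_map, hfcslen]
    · intro n h₁ h₂
      rw [List.get_ofFn]
      simp [G]
  have hfst : fcs.map Prod.fst = fs.map Prod.fst ++ [ℓ] := by
    rw [hfcs, List.map_append]; rfl
  have hreg' : ∀ (n : ℕ) (hn : n < r + 1) (u : P k r),
      G ⟨n, hn⟩ * u ∈ Ideal.ofList ((List.ofFn G).take n) →
        u ∈ Ideal.ofList ((List.ofFn G).take n) := by
    intro n hn u hu
    rw [hofFn, hfst] at hu ⊢
    have hGn' : G ⟨n, hn⟩ = (fcs.map Prod.fst)[n]'(by rw [List.length_map, hfcslen]; exact hn) := by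
      simp [G, List.getElem_map]
    have hGn : G ⟨n, hn⟩ = (fs.map Prod.fst ++ [ℓ])[n]'(by
        rw [List.length_append, List.length_map, hlen]; exact hn) := by
      rw [hGn']
      exact List.getElem_of_eq hfst _
    rcases Nat.lt_succ_iff_lt_or_eq.1 hn with hlt | heq
    · have hlt' : n < (fs.map Prod.fst).length := by rw [List.length_map, hlen]; exact hlt
      rw [List.take_append_of_le_length hlt'.le] at hu ⊢
      rw [hGn, List.getElem_append_left hlt'] at hu
      have hw := (isSMulRegular_quotient_iff_mem_of_smul_mem _ _).mp (hreg.regular_mod_prev n hlt')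
        (fun _ : Unit => u)
      exact (mem_ideal_smul_top_iff' _ _).1 (hw ((mem_ideal_smul_top_iff' _ _).2 hu))
    · have hle : (fs.map Prod.fst).length ≤ n := by rw [List.length_map, hlen, heq]
      rw [List.take_append_of_le_length (by rw [List.length_map, hlen, heq]),
        List.take_of_length_le hle] at hu ⊢
      rw [hGn, List.getElem_append_right hle] at hu
      have hℓn : ([ℓ] : List (P k r))[n - (fs.map Prod.fst).length]'(by
          rw [List.length_map, hlen, heq, Nat.sub_self]; exact Nat.zero_lt_one) = ℓ := by
        simp [hlen, heq]
      rw [hℓn] at hu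
      have hw := hℓreg (fun _ : Unit => u)
      exact (mem_ideal_smul_top_iff' _ _).1 (hw ((mem_ideal_smul_top_iff' _ _).2 hu))
  have hAG := isArtinianGorenstein_span_of_forall_mul_mem G d hG hd hreg'
  have hσ : ∑ i, (d i - 1) = σ := by
    have h1 : ∑ i, (d i - 1) + (r + 1) = ∑ i, d i := by
      have h := (Finset.sum_add_distrib (s := (Finset.univ : Finset (Fin (r + 1))))
        (f := fun i => d i - 1) (g := fun _ => 1)).symm.trans
        (Finset.sum_congr rfl fun i _ => Nat.sub_add_cancel (hd i))
      simpa using h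
    have h2 : ∑ i, d i = (fcs.map Prod.snd).sum := by
      have : List.ofFn d = fcs.map Prod.snd := by
        apply List.ext_get
        · rw [List.length_ofFn, List.length_map, hfcslen]
        · intro n h₁ h₂
          rw [List.get_ofFn]
          simp [d]
      rw [← this, List.sum_ofFn]
    have h3 : (fcs.map Prod.snd).sum = (fs.map Prod.snd).sum + 1 := by
      rw [hfcs, List.map_append, List.sum_append]; rfl
    omega
  have hspan : Ideal.span (Set.range G) = Ideal.ofList (fs.map Prod.fst ++ [ℓ]) := by
    rw [← hfst, ← hofFn, Ideal.ofList]
    congr 1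
    ext x
    exact (List.mem_ofFn' G x).symm
  rw [← hspan, ← hσ]
  exact hAG

/-! ### The Hilbert function of a complete-intersection zero-scheme -/

variable [Infinite k]

/-- **The Hilbert function of a zero-dimensional complete intersection is symmetric:
`H_Z(n) + H_Z(n') = deg Z` for `n + n' = Σ d_i - r - 1`** (Eisenbud–Green–Harris Thm. CB7 with
`Γ' = ∅`, `Γ'' = Γ`: "the dimension of the family of curves of degree `k` containing `Γ'` (modulo
those containing all of `Γ`) [`= H_Z(k)`] is equal to the failure of `Γ''` to impose independent
conditions of curves of complementary degree `s - k` [`= deg Z - H_Z(s - k)`]"). Here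
`Z = V(f_1, …, f_r) ⊂ ℙ^r` for forms `f_i` of positive degrees `d_i` weakly regular on `S^{pt}`
(`k` infinite, `r ≥ 1`), `H_Z(n) = dim_k S_n ⧸ (f_1, …, f_r)_n`, `deg Z = Π d_i` (Bézout). Proof:
with a linear form `ℓ` regular modulo `I_Z` (saturated), `R = S ⧸ (I_Z, ℓ)` is Artinian Gorenstein
    of
socle degree `σ = Σ d_i - r` (Macaulay), so `H_R(m) = H_R(σ - m)` (Stanley) and `H_R(m) = 0` for
`m > σ`; and `H_R(m) = H_Z(m) - H_Z(m - 1)`, whence `H_Z(n) + H_Z(σ - 1 - n)` is constant `= H_Z(σ)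
= deg Z`. [cite: EisenbudGreenHarris1996, Thm. CB7, Thm. CB8]
[cite: BrunsHerzog1998, Cor. 4.4.6, Rem. 4.4.7 (a)] [cite: Hartshorne1977, I Thm. 7.7 (p. 53)] -/
theorem finrank_quotient_degPiece_add_eq_degree_completeIntersection (hr : 1 ≤ r)
    (fs : List (P k r × ℕ)) (hlen : fs.length = r) (hhom : ∀ fc ∈ fs, fc.1.IsHomogeneous fc.2)
    (hpos : ∀ fc ∈ fs, 0 < fc.2) (hreg : IsWeaklyRegular (Unit → P k r) (fs.map Prod.fst))
    {n n' : ℤ} (hnn' : n + n' + r + 1 = ((fs.map Prod.snd).sum : ℤ)) :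
    Module.finrank k ((Unit → (Ldeg k r (n - 0)).comap (toL k r).toLinearMap) ⧸
        degPiece (fun _ : Unit => (0 : ℤ))
          (Ideal.ofList (fs.map Prod.fst) • (⊤ : Submodule (P k r) (Unit → P k r))) n) +
      Module.finrank k ((Unit → (Ldeg k r (n' - 0)).comap (toL k r).toLinearMap) ⧸
        degPiece (fun _ : Unit => (0 : ℤ))
          (Ideal.ofList (fs.map Prod.fst) • (⊤ : Submodule (P k r) (Unit → P k r))) n') =
    (fs.map Prod.snd).prod := by
  set K : Submodule (P k r) (Unit → P k r) := Ideal.ofList (fs.map Prod.fst) • ⊤ with hKdef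
  have hhom' : ∀ g ∈ fs.map Prod.fst, ∃ c : ℕ, g.IsHomogeneous c := by
    intro g hg
    obtain ⟨fc, hfc, rfl⟩ := List.mem_map.1 hg
    exact ⟨fc.2, hhom fc hfc⟩
  have hK : IsGraded (fun _ : Unit => (0 : ℤ)) K := isGraded_ofList_smul_top (fun _ : Unit => (0 :
      ℤ)) _ hhom'
  have hKsat : sat K = K :=
    sat_ofList_smul_top_eq hr _ hhom' hreg (by rw [List.length_map, hlen])
  have hsum : r ≤ (fs.map Prod.snd).sum := by
    have h := List.length_le_sum_of_one_le (fs.map Prod.snd) fun i hi => by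
      obtain ⟨fc, hfc, rfl⟩ := List.mem_map.1 hi
      exact hpos fc hfc
    rwa [List.length_map, hlen] at h
  obtain ⟨σ, hσ⟩ : ∃ σ : ℕ, σ + r = (fs.map Prod.snd).sum := ⟨(fs.map Prod.snd).sum - r, by omega⟩
  -- a linear non-zero-divisor modulo `I_Z`
  obtain ⟨ℓ, hℓ0, hℓ1, hℓL, hregK⟩ := exists_linearForm_regular_of_sat_le K hKsat.le
  have hAG := isArtinianGorenstein_ofList_append_linearForm fs hlen hhom hpos hreg hℓ1 hregK hσ
  have hK₁ : Ideal.ofList (fs.map Prod.fst ++ [ℓ]) • (⊤ : Submodule (P k r) (Unit → P k r)) =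
      K ⊔ ℓ • ⊤ := ofList_append_singleton_smul_top' _ _
  -- the Hilbert functions `b = H_Z`, `a = H_R`
  set b : ℤ → ℕ := fun m => Module.finrank k ((Unit → (Ldeg k r (m - 0)).comap
    (toL k r).toLinearMap) ⧸ degPiece (fun _ : Unit => (0 : ℤ)) K m) with hbdef
  set a : ℤ → ℕ := fun m => Module.finrank k ((Unit → (Ldeg k r (m - 0)).comap
    (toL k r).toLinearMap) ⧸ degPiece (fun _ : Unit => (0 : ℤ)) (K ⊔ ℓ • (⊤ : Submodule (P k r)
        (Unit → P k r))) m)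
    with hadef
  haveI hfinF : ∀ m : ℤ, Module.Finite k (Unit → (Ldeg k r (m - 0)).comap (toL k r).toLinearMap) :=
    fun m => moduleFinite_pi_comap_toL_Ldeg (fun _ : Unit => (0 : ℤ)) m
  -- (R1) `a(m + 1) + b(m) = b(m + 1)`
  have R1 : ∀ m : ℤ, a (m + 1) + b m = b (m + 1) := fun m =>
    finrank_quotient_degPiece_sup_smul_top_add_eq (fun _ : Unit => (0 : ℤ)) hK hℓL hregK m (m + 1)
        rfl
  -- (R2) negative degrees
  have hneg : ∀ m : ℤ, m < 0 → ∀ L : Submodule (P k r) (Unit → P k r),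
      Module.finrank k ((Unit → (Ldeg k r (m - 0)).comap (toL k r).toLinearMap) ⧸
        degPiece (fun _ : Unit => (0 : ℤ)) L m) = 0 := by
    intro m hm L
    haveI : ∀ _i : Unit, Module.Finite k ((Ldeg k r (m - 0)).comap (toL k r).toLinearMap) :=
      fun _ => moduleFinite_comap_toL_Ldeg _
    have h0 : Module.finrank k (Unit → (Ldeg k r (m - 0)).comap (toL k r).toLinearMap) = 0 := by
      rw [Module.finrank_pi_fintype, Finset.sum_eq_zero_iff]
      intro j _
      rw [finrank_comap_toL_Ldeg, if_neg (by omega)]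
    have := Submodule.finrank_quotient_le (degPiece (fun _ : Unit => (0 : ℤ)) L m)
    omega
  -- (R3), (R4): `a` through the Artinian Gorenstein ring `R = S ⧸ (f, ℓ)`
  have hbridge : ∀ m : ℕ, a m + Module.finrank k (idealDegree (Ideal.ofList
      (fs.map Prod.fst ++ [ℓ])) m) =
      Module.finrank k (MvPolynomial.homogeneousSubmodule (Fin (r + 1)) k m) := by
    intro m
    obtain ⟨h1, h2⟩ := finrank_degPiece_ideal_smul_top_eq (Ideal.ofList (fs.map Prod.fst ++ [ℓ])) m
    rw [hK₁] at h2
    have := Submodule.finrank_quotient_add_finrank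
      (degPiece (fun _ : Unit => (0 : ℤ)) (K ⊔ ℓ • (⊤ : Submodule (P k r) (Unit → P k r))) m)
    rw [← h1, ← h2]
    exact this
  have R3 : ∀ m : ℕ, σ < m → a m = 0 := by
    intro m hm
    have h := hbridge m
    rw [hAG.idealDegree_eq_of_lt hm] at h
    omega
  have R4 : ∀ m m' : ℕ, m + m' = σ → a m = a m' := by
    intro m m' hmm'
    haveI : ∀ i : ℕ, Module.Finite k (MvPolynomial.homogeneousSubmodule (Fin (r + 1)) k i) :=
      fun i => Module.Finite.iff_fg.mpr (MvPolynomial.homogeneousSubmodule_fg (σ := Fin (r + 1))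
        (R := k) i)
    have h := hAG.hilbert_symm hmm'
    have h1 := hbridge m
    have h2 := hbridge m'
    have hle1 := Submodule.finrank_mono (inf_le_right : idealDegree (Ideal.ofList
      (fs.map Prod.fst ++ [ℓ])) m ≤ MvPolynomial.homogeneousSubmodule (Fin (r + 1)) k m)
    have hle2 := Submodule.finrank_mono (inf_le_right : idealDegree (Ideal.ofList
      (fs.map Prod.fst ++ [ℓ])) m' ≤ MvPolynomial.homogeneousSubmodule (Fin (r + 1)) k m')
    omega
  -- (R5) `b(m) = deg Z` eventually
  have hN : ∀ m : ℤ, ((∑ q ∈ Finset.range (r + 1), (-1 : ℤ) ^ q *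
      (Module.finrank k ((quot (fun _ : Unit => (0 : ℤ)) K m).homology q) : ℤ) : ℤ) : ℚ) =
        (C (((fs.map Prod.snd).prod : ℕ) : ℚ)).eval (m : ℚ) := by
    intro m
    rw [eulerChar_completeIntersection_dimZero hr _ hhom' hreg (by rw [List.length_map, hlen]) m,
      finrank_homology_zero_completeIntersection_dimZero hr fs hhom hreg hlen m, eval_C,
      Int.cast_natCast]
  obtain ⟨n₀, hn₀⟩ := exists_forall_finrank_quotient_degPiece_sat_eq_length (fun _ : Unit => (0 :
      ℤ)) hr hK hN
  rw [hKsat] at hn₀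
  -- (S1) `b` is constant from `σ` on, equal to `deg Z`
  have S1 : ∀ j : ℕ, b (σ + j) = b σ := by
    intro j
    induction j with
    | zero => rw [Nat.cast_zero, add_zero]
    | succ j ih =>
      have h := R1 (σ + j)
      have h0 := R3 (σ + j + 1) (by omega)
      push_cast at h h0 ⊢
      rw [← add_assoc, ← h, h0, zero_add, ih]
  have S2 : b σ = (fs.map Prod.snd).prod := by
    obtain ⟨j, hj⟩ : ∃ j : ℕ, n₀ ≤ (σ : ℤ) + j := ⟨(n₀ - σ).toNat, by omega⟩
    rw [← S1 j]
    exact hn₀ _ hj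
  -- (S3) the symmetric sums, by induction from `n = -1`
  have S3 : ∀ j : ℕ, b (-1 + j) + b (σ - j) = b σ := by
    intro j
    induction j with
    | zero =>
      rw [Nat.cast_zero, add_zero, sub_zero, hbdef]
      simp only
      rw [hneg (-1) (by norm_num) K, zero_add]
    | succ j ih =>
      have h1 := R1 (-1 + j)
      have h2 := R1 (σ - (j + 1 : ℕ))
      have hsymm : a (-1 + ((j + 1 : ℕ) : ℤ)) = a ((σ : ℤ) - (j + 1 : ℕ) + 1) := by
        rcases le_or_gt j σ with hj | hj
        · have e1 : (-1 : ℤ) + ((j + 1 : ℕ) : ℤ) = (j : ℕ) := by push_cast; ring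
          have e2 : (σ : ℤ) - ((j + 1 : ℕ) : ℤ) + 1 = ((σ - j : ℕ) : ℤ) := by push_cast [hj]; ring
          rw [e1, e2]
          exact R4 j (σ - j) (by omega)
        · have e1 : (-1 : ℤ) + ((j + 1 : ℕ) : ℤ) = (j : ℕ) := by push_cast; ring
          rw [e1, R3 j hj, hadef]
          simp only
          rw [hneg _ (by push_cast; omega) (K ⊔ ℓ • ⊤)]
      have e3 : (σ : ℤ) - ((j + 1 : ℕ) : ℤ) + 1 = σ - j := by push_cast; ring
      rw [e3] at h2 hsymm
      have e4 : (-1 : ℤ) + (j : ℕ) + 1 = -1 + ((j + 1 : ℕ) : ℤ) := by push_cast; ring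
      rw [e4] at h1
      omega
  -- conclusion
  show b n + b n' = (fs.map Prod.snd).prod
  rw [← S2]
  have hn' : n' = (σ : ℤ) - 1 - n := by omega
  subst hn'
  rcases le_or_gt (-1) n with hn1 | hn1
  · obtain ⟨j, hj⟩ : ∃ j : ℕ, n = -1 + j := ⟨(n + 1).toNat, by omega⟩
    subst hj
    have e5 : (σ : ℤ) - 1 - (-1 + (j : ℤ)) = σ - j := by ring
    rw [e5]
    exact S3 j
  · obtain ⟨j, hj⟩ : ∃ j : ℕ, (σ : ℤ) - 1 - n = σ + j := ⟨(-1 - n).toNat, by omega⟩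
    rw [hj, S1 j, hbdef]
    simp only
    rw [hneg n (by omega) K, zero_add]

/-- **`H_Z(0) = 1`** for a complete-intersection zero-scheme (`deg Z = Π d_i ≥ 1`, so
`I_Z ≠ S` and `(I_Z)_0 = 0`). [cite: Hartshorne1977, I Prop. 7.6 (p. 52)] -/
theorem finrank_quotient_degPiece_zero_completeIntersection (hr : 1 ≤ r)
    (fs : List (P k r × ℕ)) (hlen : fs.length = r) (hhom : ∀ fc ∈ fs, fc.1.IsHomogeneous fc.2)
    (hpos : ∀ fc ∈ fs, 0 < fc.2) (hreg : IsWeaklyRegular (Unit → P k r) (fs.map Prod.fst)) :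
    Module.finrank k ((Unit → (Ldeg k r (0 - 0)).comap (toL k r).toLinearMap) ⧸
        degPiece (fun _ : Unit => (0 : ℤ))
          (Ideal.ofList (fs.map Prod.fst) • (⊤ : Submodule (P k r) (Unit → P k r))) 0) = 1 := by
  haveI hfinF : ∀ m : ℤ, Module.Finite k (Unit → (Ldeg k r (m - 0)).comap (toL k r).toLinearMap) :=
    fun m => moduleFinite_pi_comap_toL_Ldeg (fun _ : Unit => (0 : ℤ)) m
  have hsum : r ≤ (fs.map Prod.snd).sum := by
    have h := List.length_le_sum_of_one_le (fs.map Prod.snd) fun i hi => by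
      obtain ⟨fc, hfc, rfl⟩ := List.mem_map.1 hi
      exact hpos fc hfc
    rwa [List.length_map, hlen] at h
  have hprod : 1 ≤ (fs.map Prod.snd).prod := by
    refine Nat.succ_le_of_lt (List.prod_pos fun d hd => ?_)
    obtain ⟨fc, hfc, rfl⟩ := List.mem_map.1 hd
    exact hpos fc hfc
  obtain ⟨σ, hσ⟩ : ∃ σ : ℕ, σ + r = (fs.map Prod.snd).sum := ⟨(fs.map Prod.snd).sum - r, by omega⟩
  -- `H(σ) = deg Z ≥ 1` (the symmetric sum at `n = σ`, `n' = -1`)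
  have hσN := finrank_quotient_degPiece_add_eq_degree_completeIntersection hr fs hlen hhom hpos hreg
    (n := σ) (n' := -1) (by omega)
  have hneg : Module.finrank k ((Unit → (Ldeg k r (-1 - 0)).comap (toL k r).toLinearMap) ⧸
      degPiece (fun _ : Unit => (0 : ℤ)) (Ideal.ofList (fs.map Prod.fst) • (⊤ : Submodule (P k r)
          (Unit → P k r))) (-1)) = 0 := by
    haveI : ∀ _i : Unit, Module.Finite k ((Ldeg k r (-1 - 0)).comap (toL k r).toLinearMap) :=
      fun _ => moduleFinite_comap_toL_Ldeg _
    have h0 : Module.finrank k (Unit → (Ldeg k r (-1 - 0)).comap (toL k r).toLinearMap) = 0 := by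
      rw [Module.finrank_pi_fintype, Finset.sum_eq_zero_iff]
      intro j _
      rw [finrank_comap_toL_Ldeg, if_neg (by omega)]
    have := Submodule.finrank_quotient_le (degPiece (fun _ : Unit => (0 : ℤ)) (Ideal.ofList
        (fs.map Prod.fst) • (⊤ : Submodule (P k r) (Unit → P k r))) (-1))
    omega
  rw [hneg, add_zero] at hσN
  -- `H(0) + dim (I_Z)_0 = 1`
  have h1 := finrank_quotient_degPiece_add_finrank_eq_choose (Ideal.ofList (fs.map Prod.fst) • (⊤
      : Submodule (P k r) (Unit → P k r))) (d := 0) le_rfl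
  rw [Int.toNat_zero, zero_add, Nat.choose_self] at h1
  -- `(I_Z)_0 ≠ (S^{pt})_0`: otherwise `1 ∈ I_Z`, `I_Z = S`, `H ≡ 0`
  by_contra hne
  have h0 : Module.finrank k ((Unit → (Ldeg k r (0 - 0)).comap (toL k r).toLinearMap) ⧸
      degPiece (fun _ : Unit => (0 : ℤ)) (Ideal.ofList (fs.map Prod.fst) • (⊤ : Submodule (P k r)
          (Unit → P k r))) 0) = 0 := by omega
  have hF0 := Submodule.finrank_quotient_add_finrank (degPiece (fun _ : Unit => (0 : ℤ))
      (Ideal.ofList (fs.map Prod.fst) • (⊤ : Submodule (P k r) (Unit → P k r))) 0)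
  rw [h0, zero_add] at hF0
  have htop : degPiece (fun _ : Unit => (0 : ℤ)) (Ideal.ofList (fs.map Prod.fst) • (⊤ : Submodule
      (P k r) (Unit → P k r))) 0 = ⊤ := Submodule.eq_top_of_finrank_eq hF0
  have hone : (1 : P k r) ∈ (Ldeg k r (0 - 0)).comap (toL k r).toLinearMap := by
    rw [Submodule.mem_comap, sub_zero]
    exact (toL_mem_Ldeg_iff (1 : P k r) 0).2 (MvPolynomial.isHomogeneous_one _ _)
  have hmem : (fun _ : Unit => (⟨1, hone⟩ : (Ldeg k r (0 - 0)).comap (toL k r).toLinearMap)) ∈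
      degPiece (fun _ : Unit => (0 : ℤ)) (Ideal.ofList (fs.map Prod.fst) • (⊤ : Submodule (P k r)
          (Unit → P k r))) 0 := by rw [htop]; exact Submodule.mem_top
  rw [mem_degPiece] at hmem
  have hKtop : (Ideal.ofList (fs.map Prod.fst) • (⊤ : Submodule (P k r) (Unit → P k r))) = ⊤ :=
      eq_top_iff.2 fun v _ => by
    have : v = ∑ u : Unit, v u • (fun _ : Unit => (1 : P k r)) := by
      funext u; simp
    rw [this]
    exact Submodule.sum_mem _ fun u _ => Submodule.smul_mem _ _ hmem
  have hσtop : degPiece (fun _ : Unit => (0 : ℤ)) (Ideal.ofList (fs.map Prod.fst) • (⊤ : Submodule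
      (P k r) (Unit → P k r))) σ = ⊤ := eq_top_iff.2 fun q _ => by
    rw [mem_degPiece, hKtop]; exact Submodule.mem_top
  have hFσ := Submodule.finrank_quotient_add_finrank (degPiece (fun _ : Unit => (0 : ℤ))
      (Ideal.ofList (fs.map Prod.fst) • (⊤ : Submodule (P k r) (Unit → P k r))) σ)
  have hFσ' : Module.finrank k ↥(degPiece (fun _ : Unit => (0 : ℤ)) (Ideal.ofList (fs.map
      Prod.fst) • (⊤ : Submodule (P k r) (Unit → P k r))) σ) =
      Module.finrank k (Unit → (Ldeg k r (σ - 0)).comap (toL k r).toLinearMap) := by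
    rw [hσtop]; exact finrank_top _ _
  omega

/-- **The index of regularity of a complete-intersection zero-scheme: `H_Z(n) = deg Z ⟺
n ≥ Σ d_i - r`** ("the Hilbert function of `r` forms of degrees `d_i` meeting in `Π d_i` points
reaches `Π d_i` exactly in degree `Σ d_i - r`"). [cite: EisenbudGreenHarris1996, Thm. CB7, Thm. CB8]
[cite: BrunsHerzog1998, Cor. 4.4.6, Rem. 4.4.7 (a)] -/
theorem finrank_quotient_degPiece_eq_degree_iff_completeIntersection (hr : 1 ≤ r)
    (fs : List (P k r × ℕ)) (hlen : fs.length = r) (hhom : ∀ fc ∈ fs, fc.1.IsHomogeneous fc.2)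
    (hpos : ∀ fc ∈ fs, 0 < fc.2) (hreg : IsWeaklyRegular (Unit → P k r) (fs.map Prod.fst)) (n : ℤ) :
    Module.finrank k ((Unit → (Ldeg k r (n - 0)).comap (toL k r).toLinearMap) ⧸
        degPiece (fun _ : Unit => (0 : ℤ))
          (Ideal.ofList (fs.map Prod.fst) • (⊤ : Submodule (P k r) (Unit → P k r))) n) =
      (fs.map Prod.snd).prod ↔ ((fs.map Prod.snd).sum : ℤ) ≤ n + r := by
  haveI hfinF : ∀ m : ℤ, Module.Finite k (Unit → (Ldeg k r (m - 0)).comap (toL k r).toLinearMap) :=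
    fun m => moduleFinite_pi_comap_toL_Ldeg (fun _ : Unit => (0 : ℤ)) m
  have hhom' : ∀ g ∈ fs.map Prod.fst, ∃ c : ℕ, g.IsHomogeneous c := by
    intro g hg
    obtain ⟨fc, hfc, rfl⟩ := List.mem_map.1 hg
    exact ⟨fc.2, hhom fc hfc⟩
  have hKsat : sat (Ideal.ofList (fs.map Prod.fst) • (⊤ : Submodule (P k r) (Unit → P k r))) =
      (Ideal.ofList (fs.map Prod.fst) • (⊤ : Submodule (P k r) (Unit → P k r))) :=
    sat_ofList_smul_top_eq hr _ hhom' hreg (by rw [List.length_map, hlen])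
  have hsum : r ≤ (fs.map Prod.snd).sum := by
    have h := List.length_le_sum_of_one_le (fs.map Prod.snd) fun i hi => by
      obtain ⟨fc, hfc, rfl⟩ := List.mem_map.1 hi
      exact hpos fc hfc
    rwa [List.length_map, hlen] at h
  obtain ⟨σ, hσ⟩ : ∃ σ : ℕ, σ + r = (fs.map Prod.snd).sum := ⟨(fs.map Prod.snd).sum - r, by omega⟩
  have hsym := finrank_quotient_degPiece_add_eq_degree_completeIntersection hr fs hlen hhom hpos
      hreg
    (n := n) (n' := σ - 1 - n) (by omega)
  have h0 := finrank_quotient_degPiece_zero_completeIntersection hr fs hlen hhom hpos hreg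
  constructor
  · intro h
    by_contra hlt
    -- `σ - 1 - n ≥ 0`, so `H(σ - 1 - n) ≥ H(0) = 1`
    obtain ⟨ℓ, -, -, hℓL, hregK⟩ := exists_linearForm_regular_of_sat_le (Ideal.ofList (fs.map
        Prod.fst) • (⊤ : Submodule (P k r) (Unit → P k r))) hKsat.le
    have hmono := finrank_quotient_degPiece_mono_of_regular (fun _ : Unit => (0 : ℤ)) hℓL
        (Ideal.ofList (fs.map Prod.fst) • (⊤ : Submodule (P k r) (Unit → P k r))) hregK
      (d := 0) (d' := σ - 1 - n) (by omega)
    omega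
  · intro h
    have hneg : Module.finrank k ((Unit → (Ldeg k r (σ - 1 - n - 0)).comap
        (toL k r).toLinearMap) ⧸ degPiece (fun _ : Unit => (0 : ℤ)) (Ideal.ofList (fs.map
            Prod.fst) • (⊤ : Submodule (P k r) (Unit → P k r))) (σ - 1 - n)) = 0 := by
      haveI : ∀ _i : Unit, Module.Finite k ((Ldeg k r (σ - 1 - n - 0)).comap
          (toL k r).toLinearMap) := fun _ => moduleFinite_comap_toL_Ldeg _
      have h0' : Module.finrank k (Unit → (Ldeg k r (σ - 1 - n - 0)).comap
          (toL k r).toLinearMap) = 0 := by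
        rw [Module.finrank_pi_fintype, Finset.sum_eq_zero_iff]
        intro j _
        rw [finrank_comap_toL_Ldeg, if_neg (by omega)]
      have := Submodule.finrank_quotient_le (degPiece (fun _ : Unit => (0 : ℤ)) (Ideal.ofList
          (fs.map Prod.fst) • (⊤ : Submodule (P k r) (Unit → P k r))) (σ - 1 - n))
      omega
    omega

/-- **`H_Z(Σ d_i - r - 1) = deg Z - 1`**: a complete-intersection zero-scheme of type
`(d_1, …, d_r)` fails by exactly one to impose independent conditions on the forms of degree
`s = Σ d_i - r - 1` (`h¹(𝓘_Z(s)) = 1`; for two plane cubics: the nine points impose only eight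
conditions on cubics). [cite: EisenbudGreenHarris1996, Thm. CB4, Thm. CB7]
[cite: Hartshorne1977, III Ex. 5.5 (p. 231)] -/
theorem finrank_quotient_degPiece_completeIntersection_socle_pred (hr : 1 ≤ r)
    (fs : List (P k r × ℕ)) (hlen : fs.length = r) (hhom : ∀ fc ∈ fs, fc.1.IsHomogeneous fc.2)
    (hpos : ∀ fc ∈ fs, 0 < fc.2) (hreg : IsWeaklyRegular (Unit → P k r) (fs.map Prod.fst))
    {n : ℤ} (hn : n + r + 1 = ((fs.map Prod.snd).sum : ℤ)) :
    Module.finrank k ((Unit → (Ldeg k r (n - 0)).comap (toL k r).toLinearMap) ⧸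
        degPiece (fun _ : Unit => (0 : ℤ))
          (Ideal.ofList (fs.map Prod.fst) • (⊤ : Submodule (P k r) (Unit → P k r))) n) + 1 =
      (fs.map Prod.snd).prod := by
  have h := finrank_quotient_degPiece_add_eq_degree_completeIntersection hr fs hlen hhom hpos hreg
    (n := n) (n' := 0) (by omega)
  rwa [finrank_quotient_degPiece_zero_completeIntersection hr fs hlen hhom hpos hreg] at h

/-- **The regularity of the ideal sheaf of a complete-intersection zero-scheme is EXACTLY
`Σ d_i - r + 1`** (`r ≥ 2`): `𝓘_Z` is `m`-regular iff `m ≥ Σ d_i - r + 1` (the tree's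
`regular_idealSheaf…`/Koszul bound is attained). For `m ≥ 1` this is the index of regularity
(`ProjectiveZeroDimensionalRegularity.regular_cech_iff_choose_eq`); for `m ≤ 0` no zero-scheme's
ideal sheaf is `m`-regular (`H¹(𝓘_Z(-1)) ⊇ H⁰(𝒪_Z(-1)) ≠ 0`). [cite: Eisenbud2005, Thm. 4.2 (3),
Cor. 4.8] [cite: EisenbudGreenHarris1996, Thm. CB7] -/
theorem regular_cech_completeIntersection_dimZero_iff (hr : 2 ≤ r)
    (fs : List (P k r × ℕ)) (hlen : fs.length = r) (hhom : ∀ fc ∈ fs, fc.1.IsHomogeneous fc.2)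
    (hpos : ∀ fc ∈ fs, 0 < fc.2) (hreg : IsWeaklyRegular (Unit → P k r) (fs.map Prod.fst)) (m : ℤ) :
    (∀ i : ℤ, 1 ≤ i → IsZero ((cech (fun _ : Unit => (0 : ℤ))
        (Ideal.ofList (fs.map Prod.fst) • (⊤ : Submodule (P k r) (Unit → P k r))) (m - i)).homology
          i)) ↔ ((fs.map Prod.snd).sum : ℤ) + 1 ≤ m + r := by
  have hr1 : 1 ≤ r := one_le_two.trans hr
  haveI hfinF : ∀ m : ℤ, Module.Finite k (Unit → (Ldeg k r (m - 0)).comap (toL k r).toLinearMap) :=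
    fun m => moduleFinite_pi_comap_toL_Ldeg (fun _ : Unit => (0 : ℤ)) m
  have hhom' : ∀ g ∈ fs.map Prod.fst, ∃ c : ℕ, g.IsHomogeneous c := by
    intro g hg
    obtain ⟨fc, hfc, rfl⟩ := List.mem_map.1 hg
    exact ⟨fc.2, hhom fc hfc⟩
  have hK : IsGraded (fun _ : Unit => (0 : ℤ))
      (Ideal.ofList (fs.map Prod.fst) • (⊤ : Submodule (P k r) (Unit → P k r))) :=
    isGraded_ofList_smul_top _ _ hhom'
  have hKsat : sat (Ideal.ofList (fs.map Prod.fst) • (⊤ : Submodule (P k r) (Unit → P k r))) =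
      (Ideal.ofList (fs.map Prod.fst) • (⊤ : Submodule (P k r) (Unit → P k r))) :=
    sat_ofList_smul_top_eq hr1 _ hhom' hreg (by rw [List.length_map, hlen])
  have hprod : 1 ≤ (fs.map Prod.snd).prod := by
    refine Nat.succ_le_of_lt (List.prod_pos fun d hd => ?_)
    obtain ⟨fc, hfc, rfl⟩ := List.mem_map.1 hd
    exact hpos fc hfc
  have hN : ∀ n : ℤ, ((∑ q ∈ Finset.range (r + 1), (-1 : ℤ) ^ q *
      (Module.finrank k ((quot (fun _ : Unit => (0 : ℤ)) (Ideal.ofList (fs.map Prod.fst) • (⊤ :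
          Submodule (P k r) (Unit → P k r))) n).homology q) : ℤ) : ℤ) : ℚ) =
        (C (((fs.map Prod.snd).prod : ℕ) : ℚ)).eval (n : ℚ) := by
    intro n
    rw [eulerChar_completeIntersection_dimZero hr1 _ hhom' hreg (by rw [List.length_map, hlen]) n,
      finrank_homology_zero_completeIntersection_dimZero hr1 fs hhom hreg hlen n, eval_C,
      Int.cast_natCast]
  rcases lt_or_ge m 1 with hm | hm
  · -- `m ≤ 0`: never regular
    constructor
    · intro hregm
      exfalso
      have h1 : IsZero ((cech (fun _ : Unit => (0 : ℤ)) (Ideal.ofList (fs.map Prod.fst) • (⊤ :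
          Submodule (P k r) (Unit → P k r))) (-1)).homology 1) :=
        isZero_homology_cech_of_regular _ hK m hregm 1 le_rfl (-1) (by omega)
      have hsurj := (surjective_alphaH0_iff_isZero_homology_one (fun _ : Unit => (0 : ℤ))
          (Ideal.ofList (fs.map Prod.fst) • (⊤ : Submodule (P k r) (Unit → P k r))) (-1)
        hr).2 h1
      haveI : ∀ _i : Unit, Module.Finite k ((Ldeg k r (-1 - 0)).comap (toL k r).toLinearMap) :=
        fun _ => moduleFinite_comap_toL_Ldeg _
      haveI : Subsingleton (Unit → (Ldeg k r (-1 - 0)).comap (toL k r).toLinearMap) := by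
        rw [← Module.finrank_zero_iff (R := k), Module.finrank_pi_fintype, Finset.sum_eq_zero_iff]
        intro j _
        rw [finrank_comap_toL_Ldeg, if_neg (by norm_num)]
      haveI := hsurj.subsingleton
      have hfin := finrank_homology_quot_zero_eq_eval_of_natDegree_eq_zero (fun _ : Unit => (0 : ℤ))
        hr1 hK hN (natDegree_C _) (-1)
      rw [Module.finrank_zero_of_subsingleton, eval_C, Nat.cast_zero] at hfin
      have : ((fs.map Prod.snd).prod : ℚ) = 0 := hfin.symm
      exact absurd (by exact_mod_cast this) (Nat.one_le_iff_ne_zero.1 hprod)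
    · intro h; exfalso
      have hsum : r ≤ (fs.map Prod.snd).sum := by
        have h' := List.length_le_sum_of_one_le (fs.map Prod.snd) fun i hi => by
          obtain ⟨fc, hfc, rfl⟩ := List.mem_map.1 hi
          exact hpos fc hfc
        rwa [List.length_map, hlen] at h'
      omega
  · rw [regular_cech_iff_choose_eq hr hK hN hm, hKsat,
      ← finrank_quotient_degPiece_add_finrank_eq_choose (Ideal.ofList (fs.map Prod.fst) • (⊤ :
          Submodule (P k r) (Unit → P k r))) (d := m - 1) (by omega)]
    have hiff := finrank_quotient_degPiece_eq_degree_iff_completeIntersection hr1 fs hlen hhom hpos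
      hreg (m - 1)
    constructor
    · intro h
      have := hiff.1 (by omega)
      omega
    · intro h
      have := hiff.2 (by omega)
      omega

end LaurentCech

end Literature.Algebra.Homology

end
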